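import Literature.RingTheory.OrderOfVanishing.LatticeDeterminant
import Mathlib.RingTheory.Spectrum.Prime.Topology
import Mathlib.RingTheory.Artinian.Module
import Mathlib.RingTheory.LocalRing.Length
import Mathlib.RingTheory.Localization.AtPrime.Basic
import Mathlib.RingTheory.Localization.Ideal
import Mathlib.RingTheory.QuasiFinite.Basic
import Mathlib.RingTheory.LocalRing.ResidueField.Instances
import Mathlib.RingTheory.RamificationInertia.Inertia
import Mathlib.Algebra.BigOperators.Finprod
import Mathlib.RingTheory.Norm.Basic
import HarnessLib

/-!
# Orders of vanishing and norms: `ord_A(Nm b) = Σ_𝔪 [κ(𝔪):κ(𝔪_A)] ord_{B_𝔪}(b)` (Stacks 02MJ)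

Let `A` be a Noetherian local ring of Krull dimension `≤ 1`, `A ⊆ B` a finite extension of rings
with `B` a domain (so `A` is a domain and `B` is semi-local), `K = Frac A ⊆ L = Frac B` (a finite
extension) and `b ∈ B ∖ 0`.  We prove Stacks, Algebra, Lemma 10.121.8 (Tag 02MJ) — the algebra
behind "proper push-forward of a principal divisor is the principal divisor of the norm"
(Stacks Tag 02RT, Fulton *Intersection Theory* Prop. 1.4 (b);
`Literature.AlgebraicGeometry.Motives.map_div_eq_div_norm`) — in three proved statements:

* `Literature.RingTheory.OrderOfVanishing.length_quotient_span_singleton_eq_finsum`: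
  `ℓ_A(B/bB) = Σ_𝔪 [κ(𝔪) : κ(𝔪_A)] · ord_{B_𝔪}(b)`, the sum over the maximal ideals `𝔪` of `B`
  (`ord_{B_𝔪}(b) = ℓ(B_𝔪/bB_𝔪)` is Mathlib's `Ring.ord`, Stacks 02MD; `[κ(𝔪) : κ(𝔪_A)]` is
  Mathlib's `Ideal.inertiaDeg`);
* `Literature.RingTheory.OrderOfVanishing.ordFrac_norm_algebraMap_eq_length`:
  `ord_A(Nm_{L/K} b) = ℓ_A(B/bB)` (`ord_A` on `K` is Mathlib's `Ring.ordFrac A`, with values in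
  `ℤᵐ⁰`), from Stacks Tag 02MI
  (`Literature.RingTheory.OrderOfVanishing.ordFrac_det_eq_length_quotient`) applied to the
  lattice `B ⊆ L` and the multiplication by `b`, whose determinant is the norm;
* `Literature.RingTheory.OrderOfVanishing.ordFrac_norm_algebraMap`: the two combined, i.e.
  Tag 02MJ for `y = b ∈ B`; the case of `y = b/b' ∈ L^*` follows by multiplicativity and is left
  to the user.

## Proof of the length formula (Stacks, proof of 02MJ)

`B/bB` has finite `A`-length (it is killed by a nonzero `a ∈ A ∩ bB`, which exists as `b` is
integral over `A`), hence is an Artinian ring and `B/bB ≅ Π_𝔫 (B/bB)_𝔫` over its maximal ideals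
`𝔫 = 𝔪/bB` (Mathlib `MaximalSpectrum.toPiLocalizationEquiv`).  For each factor,
`ℓ_A((B/bB)_𝔫) = ℓ((B/bB)_𝔫) · [κ((B/bB)_𝔫) : κ(A)]` (Stacks Tag 02M0 = Mathlib
`IsLocalRing.length_restrictScalars`), `(B/bB)_𝔫 ≅ B_𝔪/bB_𝔪` (localisation commutes with
quotients) and `κ((B/bB)_𝔫) ≅ B/𝔪`.  Maximal ideals not containing `b` contribute `0`.
Everything here is proved; there are no definitions and no named facts.

## References

* [StacksProject] The Stacks Project, Algebra, Lemma 10.121.8 (Tag 02MJ), Definition 10.121.2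
  (Tag 02MD), Lemma 10.121.7 (Tag 02MI), Lemma 10.52.12 (Tag 02M0); Chow Homology, Lemma 42.18.1
  (Tag 02RT).
* [Fulton1998] W. Fulton, *Intersection Theory*, 2nd ed. (1998), Prop. 1.4 (b) (Case 2),
  Lemmas A.1.3, A.2.2, A.2.3, A.3, Example A.3.1.
-/

open Module IsLocalRing

namespace Literature.RingTheory.OrderOfVanishing



section LocalHom

variable {A B : Type*} [CommRing A] [IsLocalRing A] [CommRing B] [Algebra A B]
  [Algebra.IsIntegral A B] (m : Ideal B) [m.IsMaximal]

/-- Over a local ring `A`, every maximal ideal of an integral `A`-algebra lies over `𝔪_A`.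
[folklore] -/
theorem under_eq_maximalIdeal : m.under A = maximalIdeal A :=
  IsLocalRing.eq_maximalIdeal (Ideal.IsMaximal.under A m)

/-- `A → B_𝔪` is a local homomorphism for `𝔪` a maximal ideal of an integral algebra over the
local ring `A`. [folklore] -/
theorem isLocalHom_algebraMap_localization :
    IsLocalHom (algebraMap A (Localization.AtPrime m)) := by
  constructor
  intro a ha
  by_contra h
  have hmem : a ∈ maximalIdeal A := h
  rw [← under_eq_maximalIdeal m, Ideal.under_def, Ideal.mem_comap] at hmem
  have : algebraMap B (Localization.AtPrime m) (algebraMap A B a) ∈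
      maximalIdeal (Localization.AtPrime m) := by
    rw [← Localization.AtPrime.map_eq_maximalIdeal]
    exact Ideal.mem_map_of_mem _ hmem
  rw [← IsScalarTower.algebraMap_apply] at this
  exact (IsLocalRing.mem_maximalIdeal _).mp this ha

end LocalHom

section LocalFactor

variable {B : Type*} [CommRing B] (I : Ideal B) (n : Ideal (B ⧸ I)) [n.IsMaximal]

/-- For a maximal ideal `𝔫 = 𝔪/I` of `B/I`, the complement of `𝔪` maps onto the complement of `𝔫`.
[folklore] -/
theorem algebraMapSubmonoid_primeCompl_comap :
    Algebra.algebraMapSubmonoid (B ⧸ I) (n.comap (Ideal.Quotient.mk I)).primeCompl =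
      n.primeCompl := by
  ext x
  simp only [Algebra.algebraMapSubmonoid, Submonoid.mem_map, Ideal.mem_primeCompl_iff,
    Ideal.mem_comap, Ideal.Quotient.algebraMap_eq]
  constructor
  · rintro ⟨y, hy, rfl⟩; exact hy
  · intro hx
    obtain ⟨y, rfl⟩ := Ideal.Quotient.mk_surjective x
    exact ⟨y, hx, rfl⟩

/-- **Localisation commutes with quotients**: `(B/I)_𝔫 ≅ B_𝔪 / I B_𝔪` for `𝔫 = 𝔪/I` a maximal
ideal of `B/I`, so that `ℓ((B/I)_𝔫) = ℓ_{B_𝔪}(B_𝔪 / I B_𝔪)` (lengths over themselves, resp. over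
`B_𝔪`). [folklore] -/
theorem length_localization_quotient (m : Ideal B) [m.IsMaximal]
    (hm : n.comap (Ideal.Quotient.mk I) = m) :
    Module.length (Localization.AtPrime n) (Localization.AtPrime n) =
      Module.length (Localization.AtPrime m)
        (Localization.AtPrime m ⧸ I.map (algebraMap B (Localization.AtPrime m))) := by
  subst hm
  haveI : IsLocalization n.primeCompl (Localization.AtPrime (n.comap (Ideal.Quotient.mk I)) ⧸
      I.map (algebraMap B (Localization.AtPrime (n.comap (Ideal.Quotient.mk I))))) := by
    rw [← algebraMapSubmonoid_primeCompl_comap I n]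
    infer_instance
  -- the ring isomorphism `(B/I)_𝔫 ≅ B_𝔪 / I B_𝔪` (uniqueness of localisations), as a linear
  -- equivalence over `(B/I)_𝔫` for the module structure it induces on the target
  let e := (IsLocalization.algEquiv n.primeCompl (Localization.AtPrime n)
    (Localization.AtPrime (n.comap (Ideal.Quotient.mk I)) ⧸
      I.map (algebraMap B (Localization.AtPrime (n.comap (Ideal.Quotient.mk I)))))).toRingEquiv
  letI := e.toRingHom.toAlgebra
  have h1 := Module.length_eq_of_surjective
    (R := Localization.AtPrime (n.comap (Ideal.Quotient.mk I)) ⧸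
      I.map (algebraMap B (Localization.AtPrime (n.comap (Ideal.Quotient.mk I)))))
    (S := Localization.AtPrime n)
    (M := Localization.AtPrime (n.comap (Ideal.Quotient.mk I)) ⧸
      I.map (algebraMap B (Localization.AtPrime (n.comap (Ideal.Quotient.mk I))))) e.surjective
  let f : (Localization.AtPrime (n.comap (Ideal.Quotient.mk I)) ⧸
      I.map (algebraMap B (Localization.AtPrime (n.comap (Ideal.Quotient.mk I))))) ≃ₗ[
        Localization.AtPrime n] Localization.AtPrime n :=
    { e.symm.toAddEquiv with
      map_smul' := fun p q ↦ by
        change e.symm (e p * q) = p * e.symm q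
        rw [map_mul, RingEquiv.symm_apply_apply] }
  rw [← f.length_eq, h1]
  exact (Module.length_eq_of_surjective
    (R := Localization.AtPrime (n.comap (Ideal.Quotient.mk I)) ⧸
      I.map (algebraMap B (Localization.AtPrime (n.comap (Ideal.Quotient.mk I)))))
    (S := Localization.AtPrime (n.comap (Ideal.Quotient.mk I))) Ideal.Quotient.mk_surjective).symm

/-- For `I = (b)`: `ℓ((B/bB)_𝔫) = ord_{B_𝔪}(b)` with `𝔫 = 𝔪/bB` (Stacks 02MD). [folklore] -/
theorem length_localization_quotient_span (b : B) (m : Ideal B) [m.IsMaximal]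
    (n : Ideal (B ⧸ Ideal.span {b})) [n.IsMaximal]
    (hm : n.comap (Ideal.Quotient.mk (Ideal.span {b})) = m) :
    Module.length (Localization.AtPrime n) (Localization.AtPrime n) =
      Ring.ord (Localization.AtPrime m) (algebraMap B (Localization.AtPrime m) b) := by
  rw [length_localization_quotient (Ideal.span {b}) n m hm, Ring.ord]
  have h : (Ideal.span {b}).map (algebraMap B (Localization.AtPrime m)) =
      Ideal.span {algebraMap B (Localization.AtPrime m) b} := by
    rw [Ideal.map_span, Set.image_singleton]
  exact (Submodule.quotEquivOfEq _ _ h).length_eq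

end LocalFactor

section ResidueFactor

variable {A : Type*} [CommRing A] [IsLocalRing A] {B : Type*} [CommRing B] [Algebra A B]
  [Module.Finite A B] (I : Ideal B) (n : Ideal (B ⧸ I)) [n.IsMaximal] (m : Ideal B) [m.IsMaximal]

/-- `B → κ((B/I)_𝔫)` is surjective (`κ((B/I)_𝔫) = (B/I)/𝔫`, localisation preserves residue fields).
[folklore] -/
theorem algebraMap_residueField_localization_surjective :
    Function.Surjective (algebraMap B (ResidueField (Localization.AtPrime n))) := by
  intro z
  obtain ⟨w, rfl⟩ := Ideal.Quotient.mk_surjective z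
  obtain ⟨y, hy⟩ :=
    (IsLocalization.AtPrime.equivQuotMaximalIdeal n (Localization.AtPrime n)).surjective
      (Ideal.Quotient.mk _ w)
  obtain ⟨x', rfl⟩ := Ideal.Quotient.mk_surjective y
  obtain ⟨x, rfl⟩ := Ideal.Quotient.mk_surjective x'
  refine ⟨x, ?_⟩
  rw [IsLocalization.AtPrime.equivQuotMaximalIdeal_apply_mk] at hy
  rw [IsScalarTower.algebraMap_apply B (B ⧸ I) (ResidueField (Localization.AtPrime n)),
    IsScalarTower.algebraMap_apply (B ⧸ I) (Localization.AtPrime n)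
      (ResidueField (Localization.AtPrime n)), Ideal.Quotient.algebraMap_eq]
  exact hy

omit [m.IsMaximal] in
/-- The kernel of `B → κ((B/I)_𝔫)` is `𝔪`, the preimage of `𝔫`. [folklore] -/
theorem ker_algebraMap_residueField_localization (hm : n.comap (Ideal.Quotient.mk I) = m) :
    RingHom.ker (algebraMap B (ResidueField (Localization.AtPrime n))) = m := by
  ext x
  rw [RingHom.mem_ker,
    IsScalarTower.algebraMap_apply B (B ⧸ I) (ResidueField (Localization.AtPrime n)),
    IsScalarTower.algebraMap_apply (B ⧸ I) (Localization.AtPrime n)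
      (ResidueField (Localization.AtPrime n)), Ideal.Quotient.algebraMap_eq,
    IsLocalRing.ResidueField.algebraMap_eq, IsLocalRing.residue_eq_zero_iff,
    IsLocalization.AtPrime.to_map_mem_maximal_iff (Localization.AtPrime n) n, ← hm, Ideal.mem_comap]

/-- **The residue degree of a local factor**: for `𝔫 = 𝔪/I` a maximal ideal of `B/I`, `B` finite
over the local ring `A`, the residue field `κ((B/I)_𝔫) ≅ B/𝔪` has
`ℓ_{κ(A)}(κ((B/I)_𝔫)) = [κ(𝔪) : κ(𝔪_A)]` (Mathlib `Ideal.inertiaDeg`). [folklore] -/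
theorem length_residueField_localization (hm : n.comap (Ideal.Quotient.mk I) = m)
    [IsLocalHom (algebraMap A (Localization.AtPrime n))] :
    Module.length (ResidueField A) (ResidueField (Localization.AtPrime n)) =
      (m.inertiaDeg A : ℕ∞) := by
  haveI : Algebra.IsIntegral A B := Algebra.IsIntegral.of_finite A B
  haveI : m.LiesOver (maximalIdeal A) :=
    ⟨(IsLocalRing.eq_maximalIdeal (Ideal.IsMaximal.under A m)).symm⟩
  -- (d1) lengths over `κ(A)` are lengths over `A`
  rw [← Module.length_eq_of_surjective (R := ResidueField A) (S := A)
    (M := ResidueField (Localization.AtPrime n)) IsLocalRing.residue_surjective]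
  -- (d2) `κ((B/I)_𝔫) ≅ B/𝔪` as `A`-algebras
  have hf := algebraMap_residueField_localization_surjective I n
  have hker := ker_algebraMap_residueField_localization I n m hm
  let e₁ : (B ⧸ m) ≃+* ResidueField (Localization.AtPrime n) :=
    (Ideal.quotEquivOfEq hker.symm).trans (RingHom.quotientKerEquivOfSurjective hf)
  have he₁ : ∀ x : B, e₁ (Ideal.Quotient.mk m x) =
      algebraMap B (ResidueField (Localization.AtPrime n)) x := fun x ↦ by
    simp only [e₁, RingEquiv.trans_apply, Ideal.quotEquivOfEq_mk,
      RingHom.quotientKerEquivOfSurjective_apply_mk]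
  let e : (B ⧸ m) ≃ₐ[A] ResidueField (Localization.AtPrime n) :=
    AlgEquiv.ofRingEquiv (f := e₁) fun a ↦ by
      rw [IsScalarTower.algebraMap_apply A B (B ⧸ m), Ideal.Quotient.algebraMap_eq, he₁,
        ← IsScalarTower.algebraMap_apply]
  rw [← e.toLinearEquiv.length_eq]
  -- (d3)-(d5) `ℓ_A(B/𝔪) = dim_{κ(A)} B/𝔪 = inertiaDeg`
  rw [Module.length_eq_of_surjective (R := A ⧸ maximalIdeal A) (S := A) (M := B ⧸ m)
    Ideal.Quotient.mk_surjective, Ideal.inertiaDeg_eq_of_isMaximal (maximalIdeal A) m]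
  letI := Ideal.Quotient.field (maximalIdeal A)
  haveI : Module.Finite (A ⧸ maximalIdeal A) (B ⧸ m) :=
    Module.Finite.of_restrictScalars_finite A (A ⧸ maximalIdeal A) (B ⧸ m)
  exact Module.length_eq_finrank _ _

end ResidueFactor

section Semilocal

/-- A finite algebra over a local ring is semilocal. [folklore] -/
theorem finite_maximalSpectrum (A : Type*) [CommRing A] [IsLocalRing A] (B : Type*) [CommRing B]
    [Algebra A B] [Module.Finite A B] : Finite (MaximalSpectrum B) := by
  haveI : Algebra.IsIntegral A B := Algebra.IsIntegral.of_finite A B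
  haveI : Finite ((maximalIdeal A).primesOver B) :=
    (Algebra.QuasiFinite.finite_primesOver (maximalIdeal A)).to_subtype
  refine Finite.of_injective (fun m : MaximalSpectrum B ↦
    (⟨m.asIdeal, m.isMaximal.isPrime, ⟨(IsLocalRing.eq_maximalIdeal
      (Ideal.IsMaximal.under A m.asIdeal)).symm⟩⟩ : (maximalIdeal A).primesOver B)) ?_
  intro m m' h
  exact MaximalSpectrum.ext (congrArg Subtype.val h)

end Semilocal

section Main

variable {A : Type*} [CommRing A] [IsLocalRing A] [IsNoetherianRing A] [Ring.KrullDimLE 1 A]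
  {B : Type*} [CommRing B] [IsDomain B] [Algebra A B] [Module.Finite A B] [FaithfulSMul A B]

/-- **Stacks, Algebra, Lemma 10.121.8 (Tag 02MJ), length form.** Let `A` be a Noetherian local
ring of dimension `≤ 1` and `A ⊆ B` a finite extension with `B` a domain. For `b ∈ B ∖ 0`,
`ℓ_A(B / bB) = Σ_𝔪 [κ(𝔪) : κ(𝔪_A)] · ord_{B_𝔪}(b)`, the sum over the (finitely many) maximal
ideals `𝔪` of `B` (`ord_{B_𝔪}(b) = ℓ(B_𝔪 / b B_𝔪)`, Stacks 02MD; `[κ(𝔪) : κ(𝔪_A)]` is Mathlib's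
`Ideal.inertiaDeg`). Printed proof: `B/bB ≅ Π_𝔪 (B/bB)_𝔪` and Stacks Lemma 10.52.12 (Tag 02M0,
`ℓ_A(M) = ℓ_B(M) [κ(𝔪_B) : κ(𝔪_A)]`). [cite: StacksProject, Tag 02MJ] -/
theorem length_quotient_span_singleton_eq_finsum (b : B) (hb : b ≠ 0) :
    Module.length A (B ⧸ Ideal.span {b}) =
      ∑ᶠ m : MaximalSpectrum B, (m.asIdeal.inertiaDeg A : ℕ∞) *
        Ring.ord (Localization.AtPrime m.asIdeal)
          (algebraMap B (Localization.AtPrime m.asIdeal) b) := by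
  classical
  haveI : Algebra.IsIntegral A B := Algebra.IsIntegral.of_finite A B
  haveI : Finite (MaximalSpectrum B) := finite_maximalSpectrum A B
  haveI : Fintype (MaximalSpectrum B) := Fintype.ofFinite _
  set I : Ideal B := Ideal.span {b} with hIdef
  -- Step 1: `ℓ_A(B/bB) < ∞`, so `B/bB` is an Artinian ring
  obtain ⟨a, ha, ha0⟩ : ∃ a ∈ I.comap (algebraMap A B), a ≠ 0 :=
    Submodule.exists_mem_ne_zero_of_ne_bot (Ideal.comap_ne_bot_of_integral_mem hb
      (Ideal.subset_span rfl) (Algebra.IsIntegral.isIntegral b))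
  haveI : IsDomain A := (FaithfulSMul.algebraMap_injective A B).isDomain (algebraMap A B)
  have haI : algebraMap A B a ∈ I := ha
  have hfinA : Module.length A (B ⧸ I) ≠ ⊤ := by
    rw [← (Submodule.Quotient.restrictScalarsEquiv A (I : Submodule B B)).length_eq]
    refine length_quotient_ne_top_of_smul_mem' _ (mem_nonZeroDivisors_of_ne_zero ha0) fun v ↦ ?_
    change a • v ∈ I
    rw [Algebra.smul_def]
    exact I.mul_mem_right _ haI
  haveI : IsArtinianRing (B ⧸ I) :=
    isArtinian_of_tower A (isFiniteLength_iff_isNoetherian_isArtinian.mp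
      (Module.length_ne_top_iff.mp hfinA)).2
  haveI : Fintype (MaximalSpectrum (B ⧸ I)) := Fintype.ofFinite _
  haveI : Module.Finite A (B ⧸ I) :=
    Module.Finite.of_surjective (Ideal.Quotient.mkₐ A I).toLinearMap Ideal.Quotient.mk_surjective
  haveI : Algebra.IsIntegral A (B ⧸ I) := Algebra.IsIntegral.of_finite A (B ⧸ I)
  -- Step 2: `B/bB ≅ Π_𝔫 (B/bB)_𝔫`, so `ℓ_A(B/bB) = Σ_𝔫 ℓ_A((B/bB)_𝔫)`
  rw [((MaximalSpectrum.toPiLocalizationEquiv (B ⧸ I)).toLinearEquiv.restrictScalars A).length_eq,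
    Module.length_pi_of_fintype, finsum_eq_sum_of_fintype]
  -- Step 3: the factor at `𝔫 = 𝔪/bB` is `[κ(𝔪):κ(𝔪_A)] · ord_{B_𝔪}(b)`
  let g : MaximalSpectrum (B ⧸ I) → MaximalSpectrum B := fun n ↦
    ⟨n.asIdeal.comap (Ideal.Quotient.mk I),
      Ideal.comap_isMaximal_of_surjective _ Ideal.Quotient.mk_surjective⟩
  have hfac : ∀ n : MaximalSpectrum (B ⧸ I),
      Module.length A (Localization.AtPrime n.asIdeal) =
        ((g n).asIdeal.inertiaDeg A : ℕ∞) * Ring.ord (Localization.AtPrime (g n).asIdeal)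
          (algebraMap B (Localization.AtPrime (g n).asIdeal) b) := by
    intro n
    haveI : (g n).asIdeal.IsMaximal := (g n).isMaximal
    haveI := isLocalHom_algebraMap_localization (A := A) n.asIdeal
    rw [IsLocalRing.length_restrictScalars A (Localization.AtPrime n.asIdeal),
      length_localization_quotient_span b (g n).asIdeal n.asIdeal rfl,
      length_residueField_localization I n.asIdeal (g n).asIdeal rfl, mul_comm]
  rw [Finset.sum_congr rfl fun n _ ↦ hfac n]
  -- Step 4: reindex by the maximal ideals of `B`; those not containing `b` contribute `0`
  have hg : Set.InjOn g ↑(Finset.univ : Finset (MaximalSpectrum (B ⧸ I))) := by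
    intro n _ n' _ h
    apply MaximalSpectrum.ext
    exact Ideal.comap_injective_of_surjective _ Ideal.Quotient.mk_surjective
      (congrArg MaximalSpectrum.asIdeal h)
  rw [← Finset.sum_image (f := fun m : MaximalSpectrum B ↦ (m.asIdeal.inertiaDeg A : ℕ∞) *
    Ring.ord (Localization.AtPrime m.asIdeal) (algebraMap B (Localization.AtPrime m.asIdeal) b)) hg]
  refine Finset.sum_subset (Finset.subset_univ _) fun m _ hm ↦ ?_
  have hbm : b ∉ m.asIdeal := by
    intro hbm
    apply hm
    have hIm : I ≤ m.asIdeal := (Ideal.span_singleton_le_iff_mem _).mpr hbm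
    rcases Ideal.map_eq_top_or_isMaximal_of_surjective (Ideal.Quotient.mk I)
      Ideal.Quotient.mk_surjective m.isMaximal with htop | hmax
    · exfalso
      apply m.isMaximal.ne_top
      have h := congrArg (Ideal.comap (Ideal.Quotient.mk I)) htop
      rwa [Ideal.comap_map_of_surjective _ Ideal.Quotient.mk_surjective, Ideal.comap_top,
        ← RingHom.ker_eq_comap_bot, Ideal.mk_ker, sup_eq_left.mpr hIm] at h
    · refine Finset.mem_image.mpr ⟨⟨_, hmax⟩, Finset.mem_univ _, ?_⟩
      apply MaximalSpectrum.ext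
      change (m.asIdeal.map (Ideal.Quotient.mk I)).comap (Ideal.Quotient.mk I) = m.asIdeal
      rw [Ideal.comap_map_of_surjective _ Ideal.Quotient.mk_surjective,
        ← RingHom.ker_eq_comap_bot, Ideal.mk_ker, sup_eq_left.mpr hIm]
  rw [Ring.ord_of_isUnit ((IsLocalization.AtPrime.isUnit_to_map_iff
    (Localization.AtPrime m.asIdeal) m.asIdeal b).mpr hbm), mul_zero]

end Main

section Norm

variable {A : Type*} [CommRing A] [IsLocalRing A] [IsNoetherianRing A] [Ring.KrullDimLE 1 A]
  {B : Type*} [CommRing B] [IsDomain B] [Algebra A B] [Module.Finite A B] [FaithfulSMul A B]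
  {K : Type*} [Field K] [Algebra A K] [IsFractionRing A K]
  {L : Type*} [Field L] [Algebra B L] [IsFractionRing B L] [Algebra K L] [Algebra A L]
  [IsScalarTower A B L] [IsScalarTower A K L] [FiniteDimensional K L]

/-- **`ord_A(Nm b) = ℓ_A(B/bB)`** (Stacks Tag 02MJ, proof:
`ℓ_A(B/yB) = d(B, yB) = ord_A(det_K(L →ʸ L))` by Tag 02MI applied to the lattice `B ⊆ L`;
Fulton, *Intersection Theory*, Prop. 1.4 (b), Case 2:
`ℓ_A(Coker φ) = ord_A(det φ_K)` with `N(r) = det(φ_K)`). [cite: StacksProject, Tag 02MJ] -/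
theorem ordFrac_norm_algebraMap_eq_length (b : B) (hb : b ≠ 0) :
    Module.length A (B ⧸ Ideal.span {b}) ≠ ⊤ ∧
      Ring.ordFrac A (Algebra.norm K (algebraMap B L b)) = ((Multiplicative.ofAdd
        ((Module.length A (B ⧸ Ideal.span {b})).toNat : ℤ) : Multiplicative ℤ) :
          WithZero (Multiplicative ℤ)) := by
  haveI : IsDomain A := (FaithfulSMul.algebraMap_injective A B).isDomain (algebraMap A B)
  haveI : Algebra.IsIntegral A B := Algebra.IsIntegral.of_finite A B
  -- the lattice `M = B ⊆ L`
  let f : B →ₗ[A] L := (IsScalarTower.toAlgHom A B L).toLinearMap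
  have hf : ∀ y, f y = algebraMap B L y := fun y ↦ rfl
  have hfinj : Function.Injective f := fun x y h ↦ IsFractionRing.injective B L h
  set M : Submodule A L := LinearMap.range f with hMdef
  have hM : M.FG := by
    rw [hMdef, LinearMap.range_eq_map]; exact Module.Finite.fg_top.map f
  have hMV : Submodule.span K (M : Set L) = ⊤ := by
    rw [eq_top_iff]
    rintro z -
    obtain ⟨c, c', hc', rfl⟩ := IsFractionRing.div_surjective (A := B) z
    have hc'0 : c' ≠ 0 := nonZeroDivisors.ne_zero hc'
    obtain ⟨a, ha, ha0⟩ : ∃ a ∈ (Ideal.span {c'}).comap (algebraMap A B), a ≠ 0 :=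
      Submodule.exists_mem_ne_zero_of_ne_bot (Ideal.comap_ne_bot_of_integral_mem hc'0
        (Ideal.subset_span rfl) (Algebra.IsIntegral.isIntegral c'))
    obtain ⟨d, hd⟩ := Ideal.mem_span_singleton'.mp (Ideal.mem_comap.mp ha)
    have ha' : algebraMap A L a ≠ 0 := by
      rw [IsScalarTower.algebraMap_apply A K L]
      exact (map_ne_zero _).mpr ((map_ne_zero_iff _ (IsFractionRing.injective A K)).mpr ha0)
    have hd0 : d ≠ 0 := by
      rintro rfl
      rw [zero_mul] at hd
      exact ha0 (FaithfulSMul.algebraMap_injective A B (by rw [← hd, map_zero]))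
    have hda : algebraMap A L a = algebraMap B L d * algebraMap B L c' := by
      rw [IsScalarTower.algebraMap_apply A B L, ← hd, map_mul]
    have hc'L : algebraMap B L c' ≠ 0 := (map_ne_zero_iff _ (IsFractionRing.injective B L)).mpr hc'0
    have hdL : algebraMap B L d ≠ 0 := (map_ne_zero_iff _ (IsFractionRing.injective B L)).mpr hd0
    have hz : algebraMap B L c / algebraMap B L c' =
        (algebraMap A K a)⁻¹ • algebraMap B L (c * d) := by
      rw [Algebra.smul_def, map_inv₀, ← IsScalarTower.algebraMap_apply A K L, hda, map_mul]
      field_simp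
    rw [hz]
    exact Submodule.smul_mem _ _ (Submodule.subset_span ⟨c * d, rfl⟩)
  -- multiplication by `b` on `L`
  let φ : L →ₗ[K] L := Algebra.lmul K L (algebraMap B L b)
  have hφapp : ∀ x, φ x = algebraMap B L b * x := fun x ↦ rfl
  have hφ : ∀ x ∈ M, φ.restrictScalars A x ∈ M := by
    rintro _ ⟨y, rfl⟩
    refine ⟨b * y, ?_⟩
    rw [LinearMap.restrictScalars_apply, hφapp, hf, hf, map_mul]
  have hbL : algebraMap B L b ≠ 0 := (map_ne_zero_iff _ (IsFractionRing.injective B L)).mpr hb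
  have hdet : LinearMap.det φ ≠ 0 := by
    change LinearMap.det (Algebra.lmul K L (algebraMap B L b)) ≠ 0
    rw [← Algebra.norm_apply]
    exact Algebra.norm_ne_zero_iff.mpr hbL
  obtain ⟨hfin, hord⟩ := ordFrac_det_eq_length_quotient M hM hMV φ hφ hdet
  -- `M / bM ≅ B / bB`
  let e₁ : B ≃ₗ[A] M := LinearEquiv.ofInjective f hfinj
  have he₁ : ∀ z, (e₁ z : L) = algebraMap B L z := fun z ↦ LinearEquiv.ofInjective_apply f z
  have hrange : Submodule.map e₁.toLinearMap ((Ideal.span {b}).restrictScalars A) =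
      LinearMap.range ((φ.restrictScalars A).restrict hφ) := by
    ext x
    constructor
    · rintro ⟨y, hy, rfl⟩
      obtain ⟨z, rfl⟩ := Ideal.mem_span_singleton'.mp hy
      refine ⟨e₁ z, Subtype.ext ?_⟩
      change φ (e₁ z : L) = (e₁ (z * b) : L)
      rw [hφapp, he₁, he₁, ← map_mul, mul_comm]
    · rintro ⟨x', rfl⟩
      obtain ⟨z, rfl⟩ : ∃ z, e₁ z = x' := e₁.surjective x'
      refine ⟨z * b, Ideal.mem_span_singleton'.mpr ⟨z, rfl⟩, Subtype.ext ?_⟩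
      change (e₁ (z * b) : L) = φ (e₁ z : L)
      rw [hφapp, he₁, he₁, ← map_mul, mul_comm]
  have hlen : Module.length A (M ⧸ LinearMap.range ((φ.restrictScalars A).restrict hφ)) =
      Module.length A (B ⧸ Ideal.span {b}) := by
    rw [← (Submodule.Quotient.equiv _ _ e₁ hrange).length_eq,
      (Submodule.Quotient.restrictScalarsEquiv A (Ideal.span {b} : Submodule B B)).length_eq]
  rw [hlen] at hfin hord
  refine ⟨hfin, ?_⟩
  rw [← hord]
  change Ring.ordFrac A (Algebra.norm K (algebraMap B L b)) =
    Ring.ordFrac A (LinearMap.det (Algebra.lmul K L (algebraMap B L b)))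
  rw [Algebra.norm_apply]

/-- **Stacks, Algebra, Lemma 10.121.8 (Tag 02MJ)** for `y = b ∈ B ∖ 0`: with `A` a Noetherian local
ring of dimension `≤ 1`, `A ⊆ B` a finite extension with `B` a domain, `K ⊆ L` the fraction fields
(`L/K` finite) and `x = Nm_{L/K}(b)`,
`ord_A(x) = Σ_𝔪 [κ(𝔪) : κ(𝔪_A)] ord_{B_𝔪}(b)`, the sum over the maximal ideals `𝔪` of the
semi-local ring `B`; here `ord_A = Ring.ordFrac A : K → ℤᵐ⁰` (Stacks 02MD), `ord_{B_𝔪}(b) =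
ℓ(B_𝔪/bB_𝔪) = Ring.ord`, `[κ(𝔪) : κ(𝔪_A)] = Ideal.inertiaDeg`. (The case of a general `y ∈ L^*`
follows by multiplicativity from `y = b/b'`.) [cite: StacksProject, Tag 02MJ] -/
theorem ordFrac_norm_algebraMap (b : B) (hb : b ≠ 0) :
    Ring.ordFrac A (Algebra.norm K (algebraMap B L b)) = ((Multiplicative.ofAdd
      ((∑ᶠ m : MaximalSpectrum B, (m.asIdeal.inertiaDeg A : ℕ∞) *
        Ring.ord (Localization.AtPrime m.asIdeal)
          (algebraMap B (Localization.AtPrime m.asIdeal) b)).toNat : ℤ) : Multiplicative ℤ) :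
            WithZero (Multiplicative ℤ)) := by
  rw [← length_quotient_span_singleton_eq_finsum b hb]
  exact (ordFrac_norm_algebraMap_eq_length (K := K) (L := L) b hb).2

end Norm

end Literature.RingTheory.OrderOfVanishing
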